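import Summits.Ventures.LatticeQCDFlow.Scaling.ReplicaExchangeDiffusive
import Summits.Ventures.LatticeQCDFlow.Scaling.TemperingMixingTimeFloor
import Summits.Ventures.LatticeQCDFlow.Scaling.ReplicaExchangeBareErgodic

/-!
HONEST FRAMING: exact (Metropolis-corrected) sampling algorithms for lattice gauge theory; figures
of merit are autocorrelation/cost numbers at stated couplings and volumes; no continuum-physics
claim.

# ReplicaExchangeDiffusiveTauInt — THE DIFFUSIVE CEILING MADE EXPLICIT: `D_j(A) ≤ 1`, HENCE
# `Gap(ptBareSampler t μ M) ≤ 3t/(v·K(K+1)(2K+1))` WITH SECTOR-FROZEN COLD REPLICAS; IDENTICAL LEVELS GIVE THE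
# SCALE-FREE `6t/(K(K+1)(2K+1))`; THE LINEAR SECTOR PROFILE HAS `τ_int ≥ v·K(K+1)(2K+1)/(3td) − ½`
# (lean-2 GEN-19, ours)

Venture-side (OURS).  Cell `lqcd-flow` (pub-lqcd), unit `pub-lqcd-lean-2-g19`, 2026-08-25.  Chapter R, file 11 —
corollaries of `Scaling/ReplicaExchangeDiffusive` (R10) in the setting of `Scaling/ReplicaExchangeBareSampler`:
the tagless replica-exchange sampler `ptBareSampler t μ M` on `Fin (K+1) → S`, a set of configurations `A`, the
disagreement mass `D_j(A) = μ_j(A)μ_{j+1}(Aᶜ) + μ_j(Aᶜ)μ_{j+1}(A)` of adjacent levels, `v ≤ μ_k(A)μ_k(Aᶜ)` (`k ≥ 1`).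

## What is proved

* `levelDisagreement_le_one` — `D_{il}(A) ≤ 1` for probability vectors.
* **`ptBareFrozenSector_spectralGap_le_one`** — no replica at a level `k ≥ 1` crosses the sector ⇒
  `Gap(ptBareSampler t μ M) ≤ 3t/(v·K(K+1)(2K+1))`, WHATEVER the hot update `M_0` (`K ≥ 1`, `0 ≤ t ≤ 1`, `|S| ≥ 2`).
* **`ptBareIdenticalFrozen_spectralGap_le`** — identical levels `μ_k = μ_0`: `D_j = 2μ_0(A)μ_0(Aᶜ)`, and the
  ceiling is the SCALE-FREE `6t/(K(K+1)(2K+1))` — `K+1` copies of one law, only the first of which tunnels, relax no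
  faster than a random walk on the ladder.
* **`ptBareSlowSector_spectralGap_le`** — NOT FROZEN, ONLY SLOW: if the replicas at levels `k ≥ 1` leave the sector
  at relative rate `Q_k(A,Aᶜ) ≤ q·μ_k(A)μ_k(Aᶜ)`, then `Gap ≤ 3td/(v·K(K+1)(2K+1)) + (1−t)q/(K+1)` — the sampler's
  gap is at most the cold replicas' own conductance out of the sector, diluted by `(1−t)/(K+1)`, plus the diffusive
  term.
* **`ptBareFrozenSector_tauInt_ge`** — for an irreducible sampler the linear sector profile
  `G(x) = Σ_k k·f_A^{(μ_k)}(x_k)` has `τ_int(G) = asympVar/(2Var) ≥ v·K(K+1)(2K+1)/(3td) − ½` (Madras–Slade route,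
  `Scaling/SimulatedTemperingModeTorpid.tauInt_ge_var_div_dirichletForm`); `…_one`: `d = 1`.
* **`ptBareFrozenSector_mixingTime_ge`** — THE COLD-START FLOOR: for an irreducible sampler that mixes to within
  `ε ≤ ½` at some time (e.g. aperiodic: `…_of_aperiodic`),
  `t_mix(ε) ≥ (v·K(K+1)(2K+1)/(3td) − 1)·log(1/(2ε))` (Levin–Peres–Wilmer Thm 12.5 via
  `Scaling/TemperingMixingTimeFloor.mixingTime_ge_of_spectralGap_le`); **`…_of_hot`** — all provisos discharged by
  `Scaling/ReplicaExchangeBareErgodic`: an irreducible HOT update, positive-diagonal updates, `0 < t < 1`.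

Reading (no numerics implied): with chapter R's floor (`Scaling/ReplicaExchangeFrozenCold`: relaxation
`≤ 96(K+1)²·max{K², (K+1)/γ₀}/(pq^K)`) the relaxation time of replica exchange over sector-frozen cold replicas is
pinned between order `K³` and order `K⁴` in sampler steps.  NOT CLAIMED: which order is the truth; anything measured.
Literature grade (cell rule): KNOWN MECHANISM, NEW TYPING; nothing cited as a fact; no new bib keys.
-/

noncomputable section

open Finset Function
open Literature.Probability.MarkovChains

namespace Summit.Ventures.LatticeQCDFlow.Scaling

variable {S : Type*} [Fintype S] [DecidableEq S] {K : ℕ}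

/-- The disagreement mass is at most one (probability vectors). [folklore] -/
theorem levelDisagreement_le_one (μ : Fin (K + 1) → S → ℝ) (hμ0 : ∀ k u, 0 ≤ μ k u) (hμ1 : ∀ k, ∑ u, μ k u = 1)
    (A : Finset S) (i l : Fin (K + 1)) :
    (∑ u ∈ A, μ i u) * (∑ u ∈ Aᶜ, μ l u) + (∑ u ∈ Aᶜ, μ i u) * ∑ u ∈ A, μ l u ≤ 1 := by
  have hci : ∑ u ∈ A, μ i u + ∑ u ∈ Aᶜ, μ i u = 1 := by rw [Finset.sum_add_sum_compl, hμ1]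
  have hcl : ∑ u ∈ A, μ l u + ∑ u ∈ Aᶜ, μ l u = 1 := by rw [Finset.sum_add_sum_compl, hμ1]
  have h1 : 0 ≤ ∑ u ∈ A, μ i u := sum_nonneg fun u _ => hμ0 i u
  have h2 : 0 ≤ ∑ u ∈ Aᶜ, μ i u := sum_nonneg fun u _ => hμ0 i u
  have h3 : 0 ≤ ∑ u ∈ A, μ l u := sum_nonneg fun u _ => hμ0 l u
  have h4 : 0 ≤ ∑ u ∈ Aᶜ, μ l u := sum_nonneg fun u _ => hμ0 l u
  calc (∑ u ∈ A, μ i u) * (∑ u ∈ Aᶜ, μ l u) + (∑ u ∈ Aᶜ, μ i u) * ∑ u ∈ A, μ l u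
      ≤ (∑ u ∈ A, μ i u) * (∑ u ∈ Aᶜ, μ l u) + (∑ u ∈ Aᶜ, μ i u) * (∑ u ∈ A, μ l u)
          + ((∑ u ∈ A, μ i u) * (∑ u ∈ A, μ l u) + (∑ u ∈ Aᶜ, μ i u) * ∑ u ∈ Aᶜ, μ l u) :=
        le_add_of_nonneg_right (add_nonneg (mul_nonneg h1 h3) (mul_nonneg h2 h4))
    _ = (∑ u ∈ A, μ i u + ∑ u ∈ Aᶜ, μ i u) * (∑ u ∈ A, μ l u + ∑ u ∈ Aᶜ, μ l u) := by ring
    _ = 1 := by rw [hci, hcl, mul_one]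

section Frozen

variable {μ : Fin (K + 1) → S → ℝ} {M : Fin (K + 1) → S → S → ℝ} {t : ℝ}

/-- **THE DIFFUSIVE CEILING, `d = 1`:** if no replica at a level `k ≥ 1` crosses the sector on its own and
`μ_k(A)μ_k(Aᶜ) ≥ v > 0` for `k ≥ 1`, then `Gap(ptBareSampler t μ M) ≤ 3t/(v·K(K+1)(2K+1))` — whatever the hot
update `M_0` is, however high the swap acceptance. [ours] -/
theorem ptBareFrozenSector_spectralGap_le_one [Nontrivial S] (hK : 1 ≤ K) (hμ : ∀ k x, 0 < μ k x)
    (hμ1 : ∀ k, ∑ u, μ k u = 1) (hM : ∀ k, IsRowStochastic (M k)) (hMrev : ∀ k, DetailedBalance (μ k) (M k))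
    (ht0 : 0 ≤ t) (ht1 : t ≤ 1) (A : Finset S) {v : ℝ} (hvpos : 0 < v)
    (hv : ∀ k : Fin (K + 1), k ≠ 0 → v ≤ (∑ u ∈ A, μ k u) * ∑ u ∈ Aᶜ, μ k u)
    (hfrozen : ∀ k : Fin (K + 1), k ≠ 0 → edgeMeasure (μ k) (M k) A Aᶜ = 0) :
    spectralGap (tensorFun μ) (ptBareSampler t μ M) ≤ 3 * t / (v * ((K : ℝ) * (K + 1) * (2 * K + 1))) := by
  have h := ptBareFrozenSector_spectralGap_le (t := t) (M := M) hK hμ hμ1 hM hMrev ht0 ht1 A hvpos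
    (fun j => levelDisagreement_le_one μ (fun k u => (hμ k u).le) hμ1 A j.castSucc j.succ) hv hfrozen
  simpa using h

/-- **IDENTICAL LEVELS, ONLY THE FIRST REPLICA TUNNELS: `Gap ≤ 6t/(K(K+1)(2K+1))`** — for `μ_k = μ_0` at every
level, `D_j(A) = 2μ_0(A)μ_0(Aᶜ)` and `v = μ_0(A)μ_0(Aᶜ)` cancel: `K+1` replicas of one law, of which only the first
crosses the sector `A` (`0 < μ_0(A) < 1`), relax no faster than a random walk on the ladder. [ours] -/
theorem ptBareIdenticalFrozen_spectralGap_le [Nontrivial S] (hK : 1 ≤ K) (hμ : ∀ k x, 0 < μ k x)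
    (hμ1 : ∀ k, ∑ u, μ k u = 1) (hM : ∀ k, IsRowStochastic (M k)) (hMrev : ∀ k, DetailedBalance (μ k) (M k))
    (ht0 : 0 ≤ t) (ht1 : t ≤ 1) (hsame : ∀ k, μ k = μ 0) (A : Finset S)
    (hA : 0 < (∑ u ∈ A, μ 0 u) * ∑ u ∈ Aᶜ, μ 0 u)
    (hfrozen : ∀ k : Fin (K + 1), k ≠ 0 → edgeMeasure (μ k) (M k) A Aᶜ = 0) :
    spectralGap (tensorFun μ) (ptBareSampler t μ M) ≤ 6 * t / ((K : ℝ) * (K + 1) * (2 * K + 1)) := by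
  have hKpos : (0 : ℝ) < K := Nat.cast_pos.mpr (by omega)
  have hd : ∀ j : Fin K, (∑ u ∈ A, μ j.castSucc u) * (∑ u ∈ Aᶜ, μ j.succ u)
      + (∑ u ∈ Aᶜ, μ j.castSucc u) * ∑ u ∈ A, μ j.succ u ≤ 2 * ((∑ u ∈ A, μ 0 u) * ∑ u ∈ Aᶜ, μ 0 u) := by
    intro j; rw [hsame j.castSucc, hsame j.succ]; apply le_of_eq; ring
  have hv : ∀ k : Fin (K + 1), k ≠ 0 → (∑ u ∈ A, μ 0 u) * (∑ u ∈ Aᶜ, μ 0 u) ≤ (∑ u ∈ A, μ k u) * ∑ u ∈ Aᶜ, μ k u :=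
    fun k _ => by rw [hsame k]
  have h := ptBareFrozenSector_spectralGap_le (t := t) (M := M) hK hμ hμ1 hM hMrev ht0 ht1 A hA hd hv hfrozen
  calc spectralGap (tensorFun μ) (ptBareSampler t μ M) ≤ _ := h
    _ = 6 * t / ((K : ℝ) * (K + 1) * (2 * K + 1)) := by
        rw [div_eq_div_iff (mul_ne_zero hA.ne' (by positivity)) (by positivity)]
        ring

/-- **NOT FROZEN, ONLY SLOW:** if the replicas at levels `k ≥ 1` leave the sector at relative rate at most `q`
(`Q_k(A,Aᶜ) ≤ q·μ_k(A)μ_k(Aᶜ)`), `D_j(A) ≤ d` and `μ_k(A)μ_k(Aᶜ) ≥ v > 0` (`k ≥ 1`), then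
`Gap(ptBareSampler t μ M) ≤ 3td/(v·K(K+1)(2K+1)) + (1−t)q/(K+1)` — the cold replicas' own conductance out of the
sector, diluted by the update frequency `(1−t)/(K+1)`, plus the diffusive term; the hot update does not enter.
[ours] -/
theorem ptBareSlowSector_spectralGap_le [Nontrivial S] (hK : 1 ≤ K) (hμ : ∀ k x, 0 < μ k x)
    (hμ1 : ∀ k, ∑ u, μ k u = 1) (hM : ∀ k, IsRowStochastic (M k)) (hMrev : ∀ k, DetailedBalance (μ k) (M k))
    (ht0 : 0 ≤ t) (ht1 : t ≤ 1) (A : Finset S) {d v q : ℝ} (hvpos : 0 < v)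
    (hd : ∀ j : Fin K, (∑ u ∈ A, μ j.castSucc u) * (∑ u ∈ Aᶜ, μ j.succ u)
      + (∑ u ∈ Aᶜ, μ j.castSucc u) * ∑ u ∈ A, μ j.succ u ≤ d)
    (hv : ∀ k : Fin (K + 1), k ≠ 0 → v ≤ (∑ u ∈ A, μ k u) * ∑ u ∈ Aᶜ, μ k u)
    (hq : ∀ k : Fin (K + 1), k ≠ 0 → edgeMeasure (μ k) (M k) A Aᶜ ≤ q * ((∑ u ∈ A, μ k u) * ∑ u ∈ Aᶜ, μ k u)) :
    spectralGap (tensorFun μ) (ptBareSampler t μ M)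
      ≤ 3 * t * d / (v * ((K : ℝ) * (K + 1) * (2 * K + 1))) + (1 - t) * q / (K + 1) := by
  have hKpos : (0 : ℝ) < K := Nat.cast_pos.mpr (by omega)
  have hnorm := linearProfile_norm_ge (μ := μ) A hv
  have hS : 0 < v * ((K : ℝ) * (K + 1) * (2 * K + 1) / 6) := by positivity
  set V := ∑ k : Fin (K + 1), ((k : ℕ) : ℝ) ^ 2 * ((∑ u ∈ A, μ k u) * ∑ u ∈ Aᶜ, μ k u) with hVdef
  have hVpos : 0 < V := lt_of_lt_of_le hS hnorm
  have hmain := ptBare_spectralGap_le_profile (t := t) (M := M) hμ hμ1 hM hMrev ht0 ht1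
    (fun k : Fin (K + 1) => ((k : ℕ) : ℝ)) A hVpos
  have hswap := linearProfile_swap_le (μ := μ) hK A hd
  -- the leak term: `Σ_k k²·Q_k(A,Aᶜ) ≤ q·V` (the hot level carries weight `0`)
  have hL : ∑ k : Fin (K + 1), ((k : ℕ) : ℝ) ^ 2 * edgeMeasure (μ k) (M k) A Aᶜ ≤ q * V := by
    rw [hVdef, Finset.mul_sum]
    refine sum_le_sum fun k _ => ?_
    by_cases hk : k = 0
    · subst hk; simp
    · calc ((k : ℕ) : ℝ) ^ 2 * edgeMeasure (μ k) (M k) A Aᶜ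
          ≤ ((k : ℕ) : ℝ) ^ 2 * (q * ((∑ u ∈ A, μ k u) * ∑ u ∈ Aᶜ, μ k u)) :=
            mul_le_mul_of_nonneg_left (hq k hk) (sq_nonneg _)
        _ = q * (((k : ℕ) : ℝ) ^ 2 * ((∑ u ∈ A, μ k u) * ∑ u ∈ Aᶜ, μ k u)) := by ring
  have hd0 : 0 ≤ d := le_trans (add_nonneg
    (mul_nonneg (sum_nonneg fun u _ => (hμ _ u).le) (sum_nonneg fun u _ => (hμ _ u).le))
    (mul_nonneg (sum_nonneg fun u _ => (hμ _ u).le) (sum_nonneg fun u _ => (hμ _ u).le))) (hd ⟨0, hK⟩)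
  have hnum : t * (1 / (2 * K) * ∑ j : Fin K, (((j.castSucc : ℕ) : ℝ) - ((j.succ : ℕ) : ℝ)) ^ 2
          * ((∑ u ∈ A, μ j.castSucc u) * (∑ u ∈ Aᶜ, μ j.succ u)
            + (∑ u ∈ Aᶜ, μ j.castSucc u) * ∑ u ∈ A, μ j.succ u))
        + (1 - t) * (1 / (K + 1) * ∑ k : Fin (K + 1), ((k : ℕ) : ℝ) ^ 2 * edgeMeasure (μ k) (M k) A Aᶜ)
      ≤ t * (d / 2) + (1 - t) * (1 / (K + 1) * (q * V)) := by
    have h1 := mul_le_mul_of_nonneg_left hswap ht0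
    have h2 : (1 - t) * (1 / (K + 1) * ∑ k : Fin (K + 1), ((k : ℕ) : ℝ) ^ 2 * edgeMeasure (μ k) (M k) A Aᶜ)
        ≤ (1 - t) * (1 / (K + 1) * (q * V)) :=
      mul_le_mul_of_nonneg_left (mul_le_mul_of_nonneg_left hL (by positivity)) (by linarith)
    linarith
  calc spectralGap (tensorFun μ) (ptBareSampler t μ M)
      ≤ _ := hmain
    _ ≤ (t * (d / 2) + (1 - t) * (1 / (K + 1) * (q * V))) / V := div_le_div_of_nonneg_right hnum hVpos.le
    _ = t * (d / 2) / V + (1 - t) * q / (K + 1) := by field_simp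
    _ ≤ t * (d / 2) / (v * ((K : ℝ) * (K + 1) * (2 * K + 1) / 6)) + (1 - t) * q / (K + 1) := by
        have := div_le_div_of_nonneg_left (by positivity : 0 ≤ t * (d / 2)) hS hnorm
        linarith
    _ = 3 * t * d / (v * ((K : ℝ) * (K + 1) * (2 * K + 1))) + (1 - t) * q / (K + 1) := by
        congr 1
        rw [div_eq_div_iff (by positivity) (by positivity)]
        ring

/-- **THE LINEAR SECTOR PROFILE STAYS CORRELATED FOR `≳ K³` STEPS:** for an irreducible tagless sampler whose replicas
at levels `k ≥ 1` never cross the sector, with `D_j(A) ≤ d` and `μ_k(A)μ_k(Aᶜ) ≥ v > 0` (`k ≥ 1`), the observable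
`G(x) = Σ_k k·f_A^{(μ_k)}(x_k)` has `τ_int(G) = asympVar/(2Var) ≥ v·K(K+1)(2K+1)/(3·t·d) − ½`. [ours] -/
theorem ptBareFrozenSector_tauInt_ge [Nontrivial S] (hK : 1 ≤ K) (hμ : ∀ k x, 0 < μ k x)
    (hμ1 : ∀ k, ∑ u, μ k u = 1) (hM : ∀ k, IsRowStochastic (M k)) (hMrev : ∀ k, DetailedBalance (μ k) (M k))
    (ht0 : 0 ≤ t) (ht1 : t ≤ 1) (hirr : IsIrreducible (ptBareSampler t μ M)) (A : Finset S) {d v : ℝ}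
    (hvpos : 0 < v)
    (hd : ∀ j : Fin K, (∑ u ∈ A, μ j.castSucc u) * (∑ u ∈ Aᶜ, μ j.succ u)
      + (∑ u ∈ Aᶜ, μ j.castSucc u) * ∑ u ∈ A, μ j.succ u ≤ d)
    (hv : ∀ k : Fin (K + 1), k ≠ 0 → v ≤ (∑ u ∈ A, μ k u) * ∑ u ∈ Aᶜ, μ k u)
    (hfrozen : ∀ k : Fin (K + 1), k ≠ 0 → edgeMeasure (μ k) (M k) A Aᶜ = 0) :
    v * ((K : ℝ) * (K + 1) * (2 * K + 1)) / (3 * t * d) - 1 / 2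
      ≤ asympVar (fun x : Fin (K + 1) → S => ∑ k : Fin (K + 1), ((k : ℕ) : ℝ) * bottleneckTestFun (μ k) A (x k))
            (tensorFun μ) (ptBareSampler t μ M)
          / (2 * lawVariance (tensorFun μ)
            (fun x : Fin (K + 1) → S => ∑ k : Fin (K + 1), ((k : ℕ) : ℝ) * bottleneckTestFun (μ k) A (x k))) := by
  set G : (Fin (K + 1) → S) → ℝ :=
    fun x => ∑ k : Fin (K + 1), ((k : ℕ) : ℝ) * bottleneckTestFun (μ k) A (x k) with hG
  have hP := ptBareSampler_isRowStochastic (M := M) hμ hM ht0 ht1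
  have hDB := ptBareSampler_detailedBalance (t := t) (M := M) hμ hMrev
  have hπ := tensorFun_pos hμ
  have hπ1 := sum_tensorFun_eq_one μ hμ1
  have hKpos : (0 : ℝ) < K := Nat.cast_pos.mpr (by omega)
  have hmean : lawMean (tensorFun μ) G = 0 :=
    ptBare_mean_profileCount (μ := μ) hμ1 (fun k : Fin (K + 1) => ((k : ℕ) : ℝ)) A
  have hVar : lawVariance (tensorFun μ) G
      = ∑ k : Fin (K + 1), ((k : ℕ) : ℝ) ^ 2 * ((∑ u ∈ A, μ k u) * ∑ u ∈ Aᶜ, μ k u) := by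
    rw [← ptBare_piInner_profileCount hμ1 (fun k : Fin (K + 1) => ((k : ℕ) : ℝ)) A]
    unfold lawVariance piInner
    rw [hmean]
    exact sum_congr rfl fun x _ => by ring
  have hnorm := linearProfile_norm_ge (μ := μ) A hv
  have hS : 0 < v * ((K : ℝ) * (K + 1) * (2 * K + 1) / 6) := by positivity
  have hVpos : 0 < lawVariance (tensorFun μ) G := by rw [hVar]; exact lt_of_lt_of_le hS hnorm
  have key := tauInt_ge_var_div_dirichletForm hπ hπ1 hP hDB hirr hVpos
  have hEpos := dirichletForm_pos_of_lawVariance_pos hπ hπ1 hP hDB hirr hVpos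
  -- the Dirichlet form is at most `t·d/2`
  have hE : dirichletForm (tensorFun μ) (ptBareSampler t μ M) G ≤ t * (d / 2) := by
    have hupd : dirichletForm (tensorFun μ) (prodKernel (fun _ : Fin (K + 1) => (1 : ℝ) / (K + 1)) M) G
        = 1 / (K + 1) * ∑ k : Fin (K + 1), ((k : ℕ) : ℝ) ^ 2 * edgeMeasure (μ k) (M k) A Aᶜ :=
      ptBare_dirichletForm_update_profileCount hμ1 hM hMrev (fun k : Fin (K + 1) => ((k : ℕ) : ℝ)) A
    have hQ0 : ∑ k : Fin (K + 1), ((k : ℕ) : ℝ) ^ 2 * edgeMeasure (μ k) (M k) A Aᶜ = 0 := by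
      refine Finset.sum_eq_zero fun k _ => ?_
      by_cases hk : k = 0
      · subst hk; simp
      · rw [hfrozen k hk, mul_zero]
    have hsw := le_trans
      (ptBare_dirichletForm_swap_profileCount_le (μ := μ) hμ hμ1 (fun k : Fin (K + 1) => ((k : ℕ) : ℝ)) A)
      (linearProfile_swap_le (μ := μ) hK A hd)
    rw [ptBare_dirichletForm_split, hupd, hQ0, mul_zero, mul_zero, add_zero]
    exact mul_le_mul_of_nonneg_left hsw ht0
  have htd : 0 < t * (d / 2) := lt_of_lt_of_le hEpos hE
  have h3td : 0 < 3 * t * d := by nlinarith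
  set V := lawVariance (tensorFun μ) G
  set E := dirichletForm (tensorFun μ) (ptBareSampler t μ M) G
  calc v * ((K : ℝ) * (K + 1) * (2 * K + 1)) / (3 * t * d) - 1 / 2
      = v * ((K : ℝ) * (K + 1) * (2 * K + 1) / 6) / (t * (d / 2)) - 1 / 2 := by
        congr 1
        rw [div_eq_div_iff h3td.ne' htd.ne']
        ring
    _ ≤ V / E - 1 / 2 := by
        have h1 : v * ((K : ℝ) * (K + 1) * (2 * K + 1) / 6) / (t * (d / 2)) ≤ V / (t * (d / 2)) :=
          div_le_div_of_nonneg_right (by rw [hVar]; exact hnorm) htd.le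
        have h2 : V / (t * (d / 2)) ≤ V / E := div_le_div_of_nonneg_left hVpos.le hEpos hE
        linarith
    _ ≤ asympVar G (tensorFun μ) (ptBareSampler t μ M) / (2 * V) := key

/-- **`d = 1`:** `τ_int(G) ≥ v·K(K+1)(2K+1)/(3t) − ½` for the linear sector profile of an irreducible sampler whose
replicas at levels `k ≥ 1` never cross the sector. [ours] -/
theorem ptBareFrozenSector_tauInt_ge_one [Nontrivial S] (hK : 1 ≤ K) (hμ : ∀ k x, 0 < μ k x)
    (hμ1 : ∀ k, ∑ u, μ k u = 1) (hM : ∀ k, IsRowStochastic (M k)) (hMrev : ∀ k, DetailedBalance (μ k) (M k))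
    (ht0 : 0 ≤ t) (ht1 : t ≤ 1) (hirr : IsIrreducible (ptBareSampler t μ M)) (A : Finset S) {v : ℝ}
    (hvpos : 0 < v) (hv : ∀ k : Fin (K + 1), k ≠ 0 → v ≤ (∑ u ∈ A, μ k u) * ∑ u ∈ Aᶜ, μ k u)
    (hfrozen : ∀ k : Fin (K + 1), k ≠ 0 → edgeMeasure (μ k) (M k) A Aᶜ = 0) :
    v * ((K : ℝ) * (K + 1) * (2 * K + 1)) / (3 * t) - 1 / 2
      ≤ asympVar (fun x : Fin (K + 1) → S => ∑ k : Fin (K + 1), ((k : ℕ) : ℝ) * bottleneckTestFun (μ k) A (x k))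
            (tensorFun μ) (ptBareSampler t μ M)
          / (2 * lawVariance (tensorFun μ)
            (fun x : Fin (K + 1) → S => ∑ k : Fin (K + 1), ((k : ℕ) : ℝ) * bottleneckTestFun (μ k) A (x k))) := by
  have h := ptBareFrozenSector_tauInt_ge (t := t) (M := M) hK hμ hμ1 hM hMrev ht0 ht1 hirr A hvpos
    (fun j => levelDisagreement_le_one μ (fun k u => (hμ k u).le) hμ1 A j.castSucc j.succ) hv hfrozen
  simpa using h

/-- **THE COLD-START FLOOR:** for an irreducible tagless sampler whose replicas at levels `k ≥ 1` never cross the sector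
(`D_j(A) ≤ d`, `μ_k(A)μ_k(Aᶜ) ≥ v > 0` for `k ≥ 1`) and which is `ε`-close to equilibrium at SOME time
(`0 < ε ≤ ½`), `t_mix(ε) ≥ (v·K(K+1)(2K+1)/(3td) − 1)·log(1/(2ε))` — Levin–Peres–Wilmer Theorem 12.5 at the second
eigenvalue. [ours] -/
theorem ptBareFrozenSector_mixingTime_ge [Nontrivial S] (hK : 1 ≤ K) (hμ : ∀ k x, 0 < μ k x)
    (hμ1 : ∀ k, ∑ u, μ k u = 1) (hM : ∀ k, IsRowStochastic (M k)) (hMrev : ∀ k, DetailedBalance (μ k) (M k))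
    (ht0 : 0 ≤ t) (ht1 : t ≤ 1) (hirr : IsIrreducible (ptBareSampler t μ M)) (A : Finset S) {d v : ℝ}
    (hvpos : 0 < v)
    (hd : ∀ j : Fin K, (∑ u ∈ A, μ j.castSucc u) * (∑ u ∈ Aᶜ, μ j.succ u)
      + (∑ u ∈ Aᶜ, μ j.castSucc u) * ∑ u ∈ A, μ j.succ u ≤ d)
    (hv : ∀ k : Fin (K + 1), k ≠ 0 → v ≤ (∑ u ∈ A, μ k u) * ∑ u ∈ Aᶜ, μ k u)
    (hfrozen : ∀ k : Fin (K + 1), k ≠ 0 → edgeMeasure (μ k) (M k) A Aᶜ = 0)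
    {ε : ℝ} (hε : 0 < ε) (hε2 : ε ≤ 1 / 2) (hmix : ∃ n, worstTvDist (ptBareSampler t μ M) (tensorFun μ) n ≤ ε) :
    (v * ((K : ℝ) * (K + 1) * (2 * K + 1)) / (3 * t * d) - 1) * Real.log (1 / (2 * ε))
      ≤ (mixingTime (ptBareSampler t μ M) (tensorFun μ) ε : ℝ) := by
  have hP := ptBareSampler_isRowStochastic (M := M) hμ hM ht0 ht1
  have hDB := ptBareSampler_detailedBalance (t := t) (M := M) hμ hMrev
  have hgap := ptBareFrozenSector_spectralGap_le (t := t) (M := M) hK hμ hμ1 hM hMrev ht0 ht1 A hvpos hd hv hfrozen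
  have hinv : v * ((K : ℝ) * (K + 1) * (2 * K + 1)) / (3 * t * d)
      = 1 / (3 * t * d / (v * ((K : ℝ) * (K + 1) * (2 * K + 1)))) := (one_div_div _ _).symm
  by_cases hu : 3 * t * d / (v * ((K : ℝ) * (K + 1) * (2 * K + 1))) < 1
  · rw [hinv]
    exact mixingTime_ge_of_spectralGap_le (tensorFun_pos hμ) (sum_tensorFun_eq_one μ hμ1) hP hDB hirr hgap hu
      hε hε2 hmix
  · -- the floor is non-positive
    have hlog : 0 ≤ Real.log (1 / (2 * ε)) := Real.log_nonneg (by rw [le_div_iff₀ (by positivity)]; linarith)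
    have hle : v * ((K : ℝ) * (K + 1) * (2 * K + 1)) / (3 * t * d) - 1 ≤ 0 := by
      rw [hinv, sub_nonpos]
      exact div_le_one_of_le₀ (not_lt.mp hu) (le_trans zero_le_one (not_lt.mp hu))
    exact le_trans (mul_nonpos_of_nonpos_of_nonneg hle hlog) (Nat.cast_nonneg _)

/-- The cold-start floor with the mixing proviso discharged by APERIODICITY. [ours] -/
theorem ptBareFrozenSector_mixingTime_ge_of_aperiodic [Nontrivial S] (hK : 1 ≤ K) (hμ : ∀ k x, 0 < μ k x)
    (hμ1 : ∀ k, ∑ u, μ k u = 1) (hM : ∀ k, IsRowStochastic (M k)) (hMrev : ∀ k, DetailedBalance (μ k) (M k))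
    (ht0 : 0 ≤ t) (ht1 : t ≤ 1) (hirr : IsIrreducible (ptBareSampler t μ M))
    (hap : IsAperiodic (ptBareSampler t μ M)) (A : Finset S) {d v : ℝ} (hvpos : 0 < v)
    (hd : ∀ j : Fin K, (∑ u ∈ A, μ j.castSucc u) * (∑ u ∈ Aᶜ, μ j.succ u)
      + (∑ u ∈ Aᶜ, μ j.castSucc u) * ∑ u ∈ A, μ j.succ u ≤ d)
    (hv : ∀ k : Fin (K + 1), k ≠ 0 → v ≤ (∑ u ∈ A, μ k u) * ∑ u ∈ Aᶜ, μ k u)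
    (hfrozen : ∀ k : Fin (K + 1), k ≠ 0 → edgeMeasure (μ k) (M k) A Aᶜ = 0)
    {ε : ℝ} (hε : 0 < ε) (hε2 : ε ≤ 1 / 2) :
    (v * ((K : ℝ) * (K + 1) * (2 * K + 1)) / (3 * t * d) - 1) * Real.log (1 / (2 * ε))
      ≤ (mixingTime (ptBareSampler t μ M) (tensorFun μ) ε : ℝ) :=
  have hP := ptBareSampler_isRowStochastic (M := M) hμ hM ht0 ht1
  ptBareFrozenSector_mixingTime_ge hK hμ hμ1 hM hMrev ht0 ht1 hirr A hvpos hd hv hfrozen hε hε2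
    (exists_worstTvDist_le hP hirr hap ((ptBareSampler_detailedBalance (t := t) (M := M) hμ hMrev).isStationary hP.2)
      (fun x => (tensorFun_pos hμ x).le) (sum_tensorFun_eq_one μ hμ1) hε)

/-- **THE COLD-START FLOOR, PROVISOS DISCHARGED:** an irreducible hot update `M_0`, positive-diagonal updates
(`M_k(u,u) > 0`) and `0 < t < 1` make the tagless sampler irreducible and aperiodic
(`Scaling/ReplicaExchangeBareErgodic`); if moreover no replica at a level `k ≥ 1` crosses the sector, then for every
`0 < ε ≤ ½`: `t_mix(ε) ≥ (v·K(K+1)(2K+1)/(3td) − 1)·log(1/(2ε))` — however good the hot update is. [ours] -/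
theorem ptBareFrozenSector_mixingTime_ge_of_hot [Nontrivial S] (hK : 1 ≤ K) (hμ : ∀ k x, 0 < μ k x)
    (hμ1 : ∀ k, ∑ u, μ k u = 1) (hM : ∀ k, IsRowStochastic (M k)) (hMrev : ∀ k, DetailedBalance (μ k) (M k))
    (hM0 : IsIrreducible (M 0)) (hMdiag : ∀ k u, 0 < M k u u) (ht0 : 0 < t) (ht1 : t < 1) (A : Finset S)
    {d v : ℝ} (hvpos : 0 < v)
    (hd : ∀ j : Fin K, (∑ u ∈ A, μ j.castSucc u) * (∑ u ∈ Aᶜ, μ j.succ u)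
      + (∑ u ∈ Aᶜ, μ j.castSucc u) * ∑ u ∈ A, μ j.succ u ≤ d)
    (hv : ∀ k : Fin (K + 1), k ≠ 0 → v ≤ (∑ u ∈ A, μ k u) * ∑ u ∈ Aᶜ, μ k u)
    (hfrozen : ∀ k : Fin (K + 1), k ≠ 0 → edgeMeasure (μ k) (M k) A Aᶜ = 0)
    {ε : ℝ} (hε : 0 < ε) (hε2 : ε ≤ 1 / 2) :
    (v * ((K : ℝ) * (K + 1) * (2 * K + 1)) / (3 * t * d) - 1) * Real.log (1 / (2 * ε))
      ≤ (mixingTime (ptBareSampler t μ M) (tensorFun μ) ε : ℝ) :=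
  ptBareFrozenSector_mixingTime_ge hK hμ hμ1 hM hMrev ht0.le ht1.le
    (ptBareSampler_isIrreducible_of_hot hμ hM hM0 ht0 ht1) A hvpos hd hv hfrozen hε hε2
    (ptBareSampler_exists_worstTvDist_le hμ hμ1 hM hMrev hM0 hMdiag ht0 ht1 hε)

end Frozen

end Summit.Ventures.LatticeQCDFlow.Scaling

end
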